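import Mathlib.Algebra.Polynomial.HasseDeriv
import Mathlib.Algebra.Polynomial.BigOperators
import Mathlib.RingTheory.Ideal.Span
import HarnessLib

/-!
# The Tschirnhausen coordinate is the Hasse–Schmidt maximal-contact element: `D^{(b−1)}(z^b + a_1 z^{b−1} + ⋯ + a_b) = b·z + a_1`

Topic: `Literature/AlgebraicGeometry/Resolution`. The classical mechanism behind maximal contact for
a hypersurface of multiplicity `b` in Weierstrass form (Abhyankar's Tschirnhausen transformation;
Kollár 2007, §2.5 / Remark 2.57 and Def. 3.79 `MC(I) = D^{b-1}(I)`; Hauser 2003 §4 (9) "a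
characteristic prime to the order"): for a monic polynomial of degree `b` in `z` over ANY
commutative ring `R`,

  `D_z^{(b−1)} (z^b + a_1 z^{b−1} + a_2 z^{b−2} + ⋯ + a_b) = b·z + a_1`

(Hasse–Schmidt derivative: `D^{(b−1)} z^{b−i} = binom(b−i, b−1) z^{1−i}`, which is `b z` for
`i = 0`, `a_1` for `i = 1`, and `0` for `i ≥ 2`). So after the Tschirnhausen normalisation
`a_1 = 0` — available iff `b` is a unit — the differential operator `D^{(b−1)}` of order `b − 1`
applied to `f` returns `b·z`: the hyperplane `z = 0` is cut out by an element of the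
(Hasse–Schmidt) maximal contact ideal, in every characteristic prime to `b`; for `b = p` the
leading term `b·z` vanishes and only `a_1` survives (no contact coordinate from `D^{(p−1)}`).

* `hasseDeriv_pred_X_pow_sub` — `D^{(b−1)}(z^{b−i}) = 0` for `2 ≤ i ≤ b`;
* `hasseDeriv_pred_weierstrass` — the displayed identity for `f = z^b + Σ_{i=1}^{b} a_i z^{b−i}`;
* `hasseDeriv_pred_weierstrass_of_tschirnhausen` — `a_1 = 0 ⇒ D^{(b−1)} f = b·z`;
* `X_mem_span_hasseDeriv_of_isUnit` — `b ∈ R^× ∧ a_1 = 0 ⇒ z ∈ (D^{(b−1)} f)`;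
* `hasseDeriv_pred_weierstrass_of_natCast_eq_zero` — `b = 0` in `R` (e.g. `b = p = char R`)
  `⇒ D^{(b−1)} f = a_1`, a constant: no coordinate.

## Sources

* J. Kollár, *Lectures on Resolution of Singularities* (2007): §2.5, Remark 2.57, Def. 3.79. [Kollar2007]
* H. Hauser, Bull. AMS 40 (2003), §4 problem (9). [Hauser2003]
-/

noncomputable section

open Polynomial
open scoped BigOperators

namespace Literature.AlgebraicGeometry.Resolution.Weierstrass

variable {R : Type*} [CommRing R]

/-- `D^{(b−1)}(z^{b−i}) = 0` for `2 ≤ i ≤ b` (the exponent `b − i < b − 1`; EGA's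
`D_p(z^q) = binom(q, p) z^{q−p}`). [cite: EGAIV4, Thm. 16.11.2 (16.11.2.1)] -/
theorem hasseDeriv_pred_X_pow_sub {b i : ℕ} (hi : 2 ≤ i) (hib : i ≤ b) :
    hasseDeriv (b - 1) ((X : R[X]) ^ (b - i)) = 0 := by
  rw [X_pow_eq_monomial, hasseDeriv_monomial, Nat.choose_eq_zero_of_lt (by omega), Nat.cast_zero,
    zero_mul, monomial_zero_right]

/-- **`D^{(b−1)}(z^b + Σ_{i=1}^{b} a_i z^{b−i}) = b·z + a_1`** over any commutative ring (`b ≥ 1`).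
[cite: Kollar2007, Def. 3.79, Remark 2.57] -/
theorem hasseDeriv_pred_weierstrass {b : ℕ} (hb : 1 ≤ b) (a : ℕ → R) :
    hasseDeriv (b - 1) ((X : R[X]) ^ b + ∑ i ∈ Finset.Icc 1 b, C (a i) * X ^ (b - i)) =
      (b : R[X]) * X + C (a 1) := by
  rw [map_add, map_sum]
  -- the leading term
  have h0 : hasseDeriv (b - 1) ((X : R[X]) ^ b) = (b : R[X]) * X := by
    rw [X_pow_eq_monomial, hasseDeriv_monomial, ← Nat.choose_symm (Nat.sub_le b 1),
      show b - (b - 1) = 1 by omega, Nat.choose_one_right, mul_one, ← C_mul_X_pow_eq_monomial,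
      pow_one, map_natCast]
  rw [h0]
  congr 1
  -- the sum: only `i = 1` survives
  rw [Finset.sum_eq_single_of_mem 1 (Finset.mem_Icc.mpr ⟨le_rfl, hb⟩)]
  · rw [← smul_eq_C_mul, LinearMap.map_smul, X_pow_eq_monomial, hasseDeriv_monomial, Nat.choose_self,
      Nat.cast_one, one_mul, Nat.sub_self, monomial_zero_left, map_one, smul_eq_C_mul, mul_one]
  · intro i hi hi1
    have hi' := Finset.mem_Icc.mp hi
    have hi2 : 2 ≤ i := by omega
    rw [← smul_eq_C_mul, LinearMap.map_smul, hasseDeriv_pred_X_pow_sub hi2 hi'.2, smul_zero]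

/-- **Tschirnhausen normal form ⇒ the contact coordinate**: if `a_1 = 0` then
`D^{(b−1)}(z^b + Σ_{i≥2} a_i z^{b−i}) = b·z`. [cite: Kollar2007, Remark 2.57, Def. 3.79] -/
theorem hasseDeriv_pred_weierstrass_of_tschirnhausen {b : ℕ} (hb : 1 ≤ b) (a : ℕ → R) (ha : a 1 = 0) :
    hasseDeriv (b - 1) ((X : R[X]) ^ b + ∑ i ∈ Finset.Icc 1 b, C (a i) * X ^ (b - i)) = (b : R[X]) * X := by
  rw [hasseDeriv_pred_weierstrass hb a, ha, map_zero, add_zero]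

/-- **Maximal contact for `b` a unit** (every characteristic prime to `b`): if `b ∈ R^×` and `a_1 = 0`,
the coordinate `z` lies in the principal ideal generated by the Hasse–Schmidt derivative `D^{(b−1)} f` of
`f = z^b + Σ_{i≥2} a_i z^{b−i}` — an element of order `b − 1` in differential operators applied to `f`
cuts out the hyperplane `z = 0` (Hauser's "characteristic prime to the order").
[cite: Hauser2003, §4 problem (9)] [cite: Kollar2007, Def. 3.79] -/
theorem X_mem_span_hasseDeriv_of_isUnit {b : ℕ} (hb : 1 ≤ b) (hu : IsUnit (b : R)) (a : ℕ → R)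
    (ha : a 1 = 0) :
    (X : R[X]) ∈ Ideal.span {hasseDeriv (b - 1) ((X : R[X]) ^ b + ∑ i ∈ Finset.Icc 1 b, C (a i) * X ^ (b - i))} := by
  rw [hasseDeriv_pred_weierstrass_of_tschirnhausen hb a ha]
  obtain ⟨u, hu⟩ := hu
  have e : (X : R[X]) = C (↑u⁻¹ : R) * ((b : R[X]) * X) := by
    rw [← mul_assoc, ← map_natCast C b, ← map_mul, ← hu, Units.inv_mul, map_one, one_mul]
  have h := Ideal.mul_mem_left _ (C (↑u⁻¹ : R)) (Ideal.mem_span_singleton_self ((b : R[X]) * X))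
  rwa [← e] at h

/-- **At `b = p` the coordinate disappears**: if `b = 0` in `R` (e.g. `b = p = char R`), then
`D^{(b−1)} f = a_1` is a constant — `D^{(p−1)}` produces no contact coordinate (the purely inseparable
case `z^p + ⋯`, where Tschirnhausen is unavailable as well). [cite: Kollar2007, Aside 3.57] -/
theorem hasseDeriv_pred_weierstrass_of_natCast_eq_zero {b : ℕ} (hb : 1 ≤ b) (hb0 : (b : R) = 0) (a : ℕ → R) :
    hasseDeriv (b - 1) ((X : R[X]) ^ b + ∑ i ∈ Finset.Icc 1 b, C (a i) * X ^ (b - i)) = C (a 1) := by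
  rw [hasseDeriv_pred_weierstrass hb a, ← map_natCast C b, hb0, map_zero, zero_mul, zero_add]

end Literature.AlgebraicGeometry.Resolution.Weierstrass

end
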